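import Summits.RiemannHypothesis.RiemannHypothesis.Theorems.PfPersistenceCoefficientRigidityTrigSum
import HarnessLib

/-!
# Coefficient rigidity of window positivity, V-a: a UNIFORM negative value of a finite cosine
sum (pub-rhpf cand-7, gen 9; mechanism/rigidity campaign; no RH claims)

Pure real analysis, refining part IV-a (`exists_trigSum_neg`).  For the summable (infinitely many
sites) rigidity theorem of part V-b one needs the negative value `-δ` of
`P(t) = ∑_{i ∈ E} a_i cos(t x_i)` and the range `t ∈ [0, T₀]` to depend only on: a lower bound
`m > 0` for the frequencies, an isolation gap `γ > 0` of the resonant frequency `x_{i₁}`, a bound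
`L ≥ ∑ |a_i|`, and `|a_{i₁}| > 0` — NOT on the (number of) other frequencies.  ALL STATEMENTS ARE
PROVED (no `sorry`); nothing here mentions ζ or RH; no sentence is DATA.

* `integral_trigSum_weight_le` — `∫₀ᵀ P(t)(1 - s cos(t x_{i₁})) dt ≤ C₀(m,γ) ∑|a_i| - |a_{i₁}| T/2`
  for every `T`, with `C₀(m,γ) = 1/m + 1/(4m) + (1/γ + 1/m)/2`, `s = a_{i₁}/|a_{i₁}|`.
* `exists_trigSum_le_uniform` — with `T₀ = 2(C₀ L + 2)/|a_{i₁}|` there is `t ∈ [0, T₀]` with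
  `P(t) ≤ -|a_{i₁}|/(4(C₀ L + 2))`.

References: folklore (Fejér-type means of almost periodic polynomials; H. Bohr 1925).
-/

set_option linter.dupNamespace false

noncomputable section

open Set MeasureTheory intervalIntegral
open scoped Real

namespace Summit.RiemannHypothesis.RiemannHypothesis.Theorems.PfPersistenceCoefficientRigidity

/-! ## §24 The weighted mean with uniform constants -/

/-- **Uniform Fejér-type bound**: if all frequencies are `≥ m > 0`, the resonant one `x_{i₁}` is
`γ`-isolated, `|s| = 1` and `s a_{i₁} = |a_{i₁}|`, then for every `T`
`∫₀ᵀ (∑ a_i cos(t x_i))(1 - s cos(t x_{i₁})) dt ≤ C₀ ∑|a_i| - |a_{i₁}| T/2`,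
`C₀ = 1/m + 1/(4m) + (1/γ + 1/m)/2`. [folklore] -/
theorem integral_trigSum_weight_le {ι : Type*} {E : Finset ι} {a x : ι → ℝ} {i₁ : ι}
    (hi₁ : i₁ ∈ E) {m γ : ℝ} (hm : 0 < m) (hγ : 0 < γ) (hxm : ∀ i ∈ E, m ≤ x i)
    (hgap : ∀ i ∈ E, i ≠ i₁ → γ ≤ |x i - x i₁|) {s : ℝ} (hs1 : |s| = 1)
    (hsc : s * a i₁ = |a i₁|) (T : ℝ) :
    ∫ t in (0 : ℝ)..T, (∑ i ∈ E, a i * Real.cos (t * x i)) * (1 - s * Real.cos (t * x i₁)) ≤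
      (1 / m + 1 / (4 * m) + (1 / γ + 1 / m) / 2) * ∑ i ∈ E, |a i| - |a i₁| * T / 2 := by
  classical
  set C₀ : ℝ := 1 / m + 1 / (4 * m) + (1 / γ + 1 / m) / 2 with hC₀
  have hx1 : 0 < x i₁ := hm.trans_le (hxm i₁ hi₁)
  have hint : ∀ i ∈ E, IntervalIntegrable
      (fun t : ℝ ↦ a i * Real.cos (t * x i) * (1 - s * Real.cos (t * x i₁))) volume 0 T :=
    fun i _ ↦ (by fun_prop : Continuous fun t : ℝ ↦
      a i * Real.cos (t * x i) * (1 - s * Real.cos (t * x i₁))).intervalIntegrable _ _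
  have hsplit : ∫ t in (0 : ℝ)..T,
      (∑ i ∈ E, a i * Real.cos (t * x i)) * (1 - s * Real.cos (t * x i₁)) =
        ∑ i ∈ E, ∫ t in (0 : ℝ)..T, a i * Real.cos (t * x i) * (1 - s * Real.cos (t * x i₁)) := by
    simp_rw [Finset.sum_mul]
    exact intervalIntegral.integral_finsetSum hint
  rw [hsplit, ← Finset.add_sum_erase E _ hi₁, ← Finset.add_sum_erase E (fun i ↦ |a i|) hi₁,
    mul_add, Finset.mul_sum]
  -- resonant term
  have h1 : ∫ t in (0 : ℝ)..T, a i₁ * Real.cos (t * x i₁) * (1 - s * Real.cos (t * x i₁)) ≤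
      C₀ * |a i₁| - |a i₁| * T / 2 := by
    have h := integral_term_self_le hsc hx1 T
    have e1 : |a i₁| / x i₁ ≤ |a i₁| / m :=
      div_le_div_of_nonneg_left (abs_nonneg _) hm (hxm i₁ hi₁)
    have e2 : |a i₁| / (4 * x i₁) ≤ |a i₁| / (4 * m) :=
      div_le_div_of_nonneg_left (abs_nonneg _) (by positivity) (by linarith [hxm i₁ hi₁])
    have e3 : |a i₁| / m + |a i₁| / (4 * m) ≤ C₀ * |a i₁| := by
      rw [hC₀]
      have : 0 ≤ (1 / γ + 1 / m) / 2 * |a i₁| := by positivity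
      have e : |a i₁| / m + |a i₁| / (4 * m) = (1 / m + 1 / (4 * m)) * |a i₁| := by ring
      rw [e]
      nlinarith [abs_nonneg (a i₁)]
    linarith
  -- the other terms
  have h2 : ∑ i ∈ E.erase i₁, ∫ t in (0 : ℝ)..T,
      a i * Real.cos (t * x i) * (1 - s * Real.cos (t * x i₁)) ≤
        ∑ i ∈ E.erase i₁, C₀ * |a i| :=
    Finset.sum_le_sum fun i hi ↦ by
      have hiE := Finset.mem_of_mem_erase hi
      have hne' : i ≠ i₁ := Finset.ne_of_mem_erase hi
      have hxi : 0 < x i := hm.trans_le (hxm i hiE)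
      have hg := hgap i hiE hne'
      have hne : x i ≠ x i₁ := fun h ↦ by
        rw [h, sub_self, abs_zero] at hg
        exact absurd hg (not_le.2 hγ)
      have h := integral_term_le_of_ne (ci := a i) hs1 hxi hx1 hne T
      have e1 : |a i| / x i ≤ |a i| / m := div_le_div_of_nonneg_left (abs_nonneg _) hm (hxm i hiE)
      have e2 : 1 / |x i - x i₁| ≤ 1 / γ := one_div_le_one_div_of_le hγ hg
      have e3 : 1 / (x i + x i₁) ≤ 1 / m :=
        one_div_le_one_div_of_le hm (by linarith [hxm i hiE])
      have e4 : |a i| * ((1 / |x i - x i₁| + 1 / (x i + x i₁)) / 2) ≤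
          |a i| * ((1 / γ + 1 / m) / 2) :=
        mul_le_mul_of_nonneg_left (by linarith) (abs_nonneg _)
      have e5 : |a i| / m + |a i| * ((1 / γ + 1 / m) / 2) ≤ C₀ * |a i| := by
        rw [hC₀]
        have : 0 ≤ 1 / (4 * m) * |a i| := by positivity
        have e : (1 / m + 1 / (4 * m) + (1 / γ + 1 / m) / 2) * |a i| =
            |a i| / m + 1 / (4 * m) * |a i| + |a i| * ((1 / γ + 1 / m) / 2) := by ring
        rw [e]
        linarith
      linarith
  linarith

/-- **Uniform negative value.**  Under the hypotheses of `integral_trigSum_weight_le`, with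
`a_{i₁} ≠ 0`, `∑ |a_i| ≤ L` and `T₀ = 2(C₀L + 2)/|a_{i₁}|`, some `t ∈ [0, T₀]` has
`∑ a_i cos(t x_i) ≤ -|a_{i₁}|/(4(C₀L + 2))` — a bound independent of the other frequencies.
[folklore] -/
theorem exists_trigSum_le_uniform {ι : Type*} {E : Finset ι} {a x : ι → ℝ} {i₁ : ι}
    (hi₁ : i₁ ∈ E) {m γ L : ℝ} (hm : 0 < m) (hγ : 0 < γ) (hxm : ∀ i ∈ E, m ≤ x i)
    (hgap : ∀ i ∈ E, i ≠ i₁ → γ ≤ |x i - x i₁|) (ha₁ : a i₁ ≠ 0)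
    (hL : ∑ i ∈ E, |a i| ≤ L) :
    ∃ t ∈ Icc (0 : ℝ)
        (2 * ((1 / m + 1 / (4 * m) + (1 / γ + 1 / m) / 2) * L + 2) / |a i₁|),
      ∑ i ∈ E, a i * Real.cos (t * x i) ≤
        -(|a i₁| / (4 * ((1 / m + 1 / (4 * m) + (1 / γ + 1 / m) / 2) * L + 2))) := by
  set C₀ : ℝ := 1 / m + 1 / (4 * m) + (1 / γ + 1 / m) / 2 with hC₀
  have hC₀0 : 0 < C₀ := by positivity
  have hα : 0 < |a i₁| := abs_pos.2 ha₁
  have hL0 : 0 ≤ L := (Finset.sum_nonneg fun i _ ↦ abs_nonneg (a i)).trans hL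
  set T₀ : ℝ := 2 * (C₀ * L + 2) / |a i₁| with hT₀
  have hT₀0 : 0 < T₀ := by positivity
  have hT₀α : |a i₁| * T₀ / 2 = C₀ * L + 2 := by
    rw [hT₀]
    field_simp
  have hδ : |a i₁| / (4 * (C₀ * L + 2)) = 1 / (2 * T₀) := by
    rw [hT₀]
    field_simp
    ring
  rw [hδ]
  set s : ℝ := a i₁ / |a i₁| with hsdef
  have hsc : s * a i₁ = |a i₁| := by
    rw [hsdef, div_mul_eq_mul_div, ← abs_mul_abs_self (a i₁)]
    exact mul_div_cancel_right₀ _ hα.ne'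
  have hs1 : |s| = 1 := by rw [hsdef, abs_div, abs_abs, div_self hα.ne']
  -- upper bound of the weighted mean
  have hup : ∫ t in (0 : ℝ)..T₀,
      (∑ i ∈ E, a i * Real.cos (t * x i)) * (1 - s * Real.cos (t * x i₁)) ≤ -2 := by
    have h := integral_trigSum_weight_le hi₁ hm hγ hxm hgap hs1 hsc T₀
    rw [← hC₀] at h
    have h' : C₀ * ∑ i ∈ E, |a i| ≤ C₀ * L := mul_le_mul_of_nonneg_left hL hC₀0.le
    linarith
  by_contra hno
  push Not at hno
  -- then the weighted mean is `≥ -1`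
  have hw0 : ∀ t : ℝ, 0 ≤ 1 - s * Real.cos (t * x i₁) := fun t ↦ by
    have h : s * Real.cos (t * x i₁) ≤ 1 := by
      calc s * Real.cos (t * x i₁) ≤ |s * Real.cos (t * x i₁)| := le_abs_self _
        _ = |s| * |Real.cos (t * x i₁)| := abs_mul _ _
        _ ≤ 1 * 1 := by
            rw [hs1]
            exact mul_le_mul_of_nonneg_left (Real.abs_cos_le_one _) zero_le_one
        _ = 1 := one_mul 1
    linarith
  have hw2 : ∀ t : ℝ, 1 - s * Real.cos (t * x i₁) ≤ 2 := fun t ↦ by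
    have h : -1 ≤ s * Real.cos (t * x i₁) := by
      have h1 : |s * Real.cos (t * x i₁)| ≤ 1 := by
        rw [abs_mul, hs1, one_mul]
        exact Real.abs_cos_le_one _
      linarith [neg_abs_le (s * Real.cos (t * x i₁))]
    linarith
  have hlow : ∫ _ in (0 : ℝ)..T₀, (-(1 / T₀) : ℝ) ≤ ∫ t in (0 : ℝ)..T₀,
      (∑ i ∈ E, a i * Real.cos (t * x i)) * (1 - s * Real.cos (t * x i₁)) := by
    refine intervalIntegral.integral_mono_on hT₀0.le intervalIntegrable_const
      ((by fun_prop : Continuous fun t : ℝ ↦ (∑ i ∈ E, a i * Real.cos (t * x i)) *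
        (1 - s * Real.cos (t * x i₁))).intervalIntegrable _ _) fun t ht ↦ ?_
    have hP := hno t ht
    set P := ∑ i ∈ E, a i * Real.cos (t * x i) with hPdef
    rcases le_or_gt 0 P with hP0 | hP0
    · have : 0 ≤ P * (1 - s * Real.cos (t * x i₁)) := mul_nonneg hP0 (hw0 t)
      have : 0 < 1 / T₀ := by positivity
      linarith
    · have h2 : P * 2 ≤ P * (1 - s * Real.cos (t * x i₁)) :=
        mul_le_mul_of_nonpos_left (hw2 t) hP0.le
      have e : -(1 / T₀) = -(1 / (2 * T₀)) * 2 := by ring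
      rw [e]
      nlinarith
  rw [intervalIntegral.integral_const, sub_zero, smul_eq_mul] at hlow
  have e : T₀ * -(1 / T₀) = -1 := by
    field_simp
  rw [e] at hlow
  linarith

end Summit.RiemannHypothesis.RiemannHypothesis.Theorems.PfPersistenceCoefficientRigidity

end
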